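import Literature.NumberTheory.LFunctions.AutomaticSequenceTransducerArith2
import HarnessLib

/-!
# Arithmetic restrictions for the naturally induced transducer, III: the invariant `d'(A)` (Müllner 2017, Lemma 2.19; proved)

Everything in this file is PROVED (plus one plain definition). It continues §2.4 of C. Müllner,
*Automatic sequences fulfill the Sarnak conjecture* (Duke Math. J. 166 (2017)) over the digit
alphabet (`k ≥ 2`, letters `≥ k` trivial), `d = transducerPeriod k δ`:

* `MinImage.dPrime hk htriv M M' c = gcd(d(q,q̄), k^d − 1)` — the factor `d'(q, q̄)` of
  `d(q,q̄) = d' d''` with `d' ∣ k^d − 1`, `d'' ∣ k^{ℓ₀}` (the paragraph after Lemma 2.18; with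
  Lemma 2.18, `dPrime_mul_gcd`: `d' · gcd(d(q,q̄), k^{ℓ₀}) = d(q,q̄)`);
* the transport of differences along fixed paths on both sides (`MinImage.dPrime_dvd_limitDiffGcd`,
  the computation in the proof of Lemma 2.19: `d(q₁,q₂) ∣ k^{|w'|} d(q̄₁,q̄₂)` up to the part
  prime to `k`);
* **Lemma 2.19** (`MinImage.dPrime_eq`): `d'` does not depend on the states — nor, in this
  class-by-class formulation, on the length class: `d'(A)`.

## References
* C. Müllner, Duke Math. J. 166 (2017), §2.4: Lemma 2.18 (decomposition `d = d' d''`),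
  Lemma 2.19. [Mullner2017]
-/

noncomputable section

open Finset

namespace Literature.NumberTheory.LFunctions

/-- `k^L` is prime to `k^d − 1` (`k, d ≥ 1`). [folklore] -/
theorem coprime_pow_pow_sub_one {k : ℕ} (hk : 0 < k) (L d : ℕ) (hd : 0 < d) :
    Nat.Coprime (k ^ L) (k ^ d - 1) := by
  have h1 : Nat.Coprime (k ^ d) (k ^ d - 1) := by
    have h : 0 < k ^ d := pow_pos hk d
    have : k ^ d = (k ^ d - 1) + 1 := by omega
    conv_lhs => rw [this]
    rw [Nat.coprime_self_add_left]
    exact Nat.coprime_one_left _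
  have h2 : Nat.Coprime k (k ^ d - 1) :=
    Nat.Coprime.coprime_dvd_left (dvd_pow_self k hd.ne') h1
  exact h2.pow_left L

namespace MinImage

variable {σ : Type*} [Fintype σ] [DecidableEq σ] {δ : σ → ℕ → σ} {k : ℕ}

/-- `d'(q, q̄)` on the class `c`: the part of `d(q,q̄)` dividing `k^d − 1` (Müllner, after
Lemma 2.18). [cite: Mullner2017, Lemma 2.18] -/
def dPrime (hk : 2 ≤ k) (htriv : ∀ q d, k ≤ d → δ q d = q) (M M' : MinImage δ)
    (c : ZMod (transducerPeriod k δ)) : ℕ :=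
  Nat.gcd (M.limitDiffGcd hk htriv M' c) (k ^ transducerPeriod k δ - 1)

/-- `d' ∣ k^d − 1`. [cite: Mullner2017, Lemma 2.18] -/
theorem dPrime_dvd_pow_sub_one (hk : 2 ≤ k) (htriv : ∀ q d, k ≤ d → δ q d = q) (M M' : MinImage δ)
    (c : ZMod (transducerPeriod k δ)) :
    M.dPrime hk htriv M' c ∣ k ^ transducerPeriod k δ - 1 :=
  Nat.gcd_dvd_right _ _

/-- `d' ∣ d(q,q̄)`. [cite: Mullner2017, Lemma 2.18] -/
theorem dPrime_dvd_limitDiffGcd_self (hk : 2 ≤ k) (htriv : ∀ q d, k ≤ d → δ q d = q)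
    (M M' : MinImage δ) (c : ZMod (transducerPeriod k δ)) :
    M.dPrime hk htriv M' c ∣ M.limitDiffGcd hk htriv M' c :=
  Nat.gcd_dvd_left _ _

/-- `d'` is prime to every power of `k`. [folklore] -/
theorem coprime_pow_dPrime (hk : 2 ≤ k) (htriv : ∀ q d, k ≤ d → δ q d = q) (M M' : MinImage δ)
    (c : ZMod (transducerPeriod k δ)) (L : ℕ) : Nat.Coprime (k ^ L) (M.dPrime hk htriv M' c) :=
  Nat.Coprime.coprime_dvd_right (M.dPrime_dvd_pow_sub_one hk htriv M' c)
    (coprime_pow_pow_sub_one (by omega) L _ (transducerPeriod_pos (by omega) htriv))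

/-- **The decomposition `d(q,q̄) = d' · d''`** with `d'' = gcd(d(q,q̄), k^{ℓ₀}) ∣ k^{ℓ₀}` (Müllner,
after Lemma 2.18), for the `ℓ₀` of Lemma 2.18. [cite: Mullner2017, Lemma 2.18] -/
theorem exists_dPrime_mul_gcd (hk : 2 ≤ k) (htriv : ∀ q d, k ≤ d → δ q d = q) :
    ∃ ℓ₀ : ℕ, ∀ (M M' : MinImage δ) (c : ZMod (transducerPeriod k δ)),
      Nat.gcd (M.limitDiffGcd hk htriv M' c) (k ^ ℓ₀) * M.dPrime hk htriv M' c =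
        M.limitDiffGcd hk htriv M' c := by
  obtain ⟨ℓ₀, hℓ₀⟩ := exists_limitDiffGcd_dvd hk htriv (δ := δ)
  refine ⟨ℓ₀, fun M M' c => ?_⟩
  have hdvd := hℓ₀ M M' c
  have hcop := coprime_pow_pow_sub_one (k := k) (by omega) ℓ₀ _
    (transducerPeriod_pos (by omega) htriv (δ := δ))
  rw [dPrime, ← Nat.Coprime.gcd_mul _ hcop]
  exact Nat.gcd_eq_left hdvd

/-! ## Lemma 2.19: `d'` is an invariant of the automaton -/

/-- **Transport of the numbers of paths** (the computation in the proof of Lemma 2.19): fix a digit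
path `u` from `M₁` to `N₁` and a digit path `v` from `N₂` to `M₂`; then `w ↦ u w v` maps the paths
of length `L` from `N₁` to `N₂` with output `g` to paths of length `|u| + L + |v|` from `M₁` to
`M₂` with output `T(u) ≫ g ≫ T(v)`, multiplying all differences of numbers by `k^{|v|}`; hence
`d_{T(u) g T(v), |u|+L+|v|}(M₁,M₂) ∣ k^{|v|} · (every difference for (N₁,N₂,g,L))`.
[cite: Mullner2017, Lemma 2.19 (proof)] -/
theorem diffGcd_dvd_mul_of_transport {M₁ N₁ N₂ M₂ : MinImage δ} {u v : List ℕ}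
    (hud : ∀ d ∈ u, d < k) (hun : M₁.next u = N₁) (hvd : ∀ d ∈ v, d < k) (hvn : N₂.next v = M₂)
    {g : Equiv.Perm (Fin (minRank δ))} {L : ℕ} {x y : ℕ} (hx : x ∈ N₁.pathVals k N₂ g L)
    (hy : y ∈ N₁.pathVals k N₂ g L) (hyx : y ≤ x) :
    M₁.diffGcd k M₂ (((M₁.T u).trans g).trans (N₂.T v)) (u.length + L + v.length) ∣
      k ^ v.length * (x - y) := by
  obtain ⟨w₁, h₁d, h₁l, h₁n, h₁T, rfl⟩ := hx
  obtain ⟨w₂, h₂d, h₂l, h₂n, h₂T, rfl⟩ := hy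
  have hmem : ∀ (w : List ℕ), (∀ d ∈ w, d < k) → w.length = L → N₁.next w = N₂ → N₁.T w = g →
      wordVal k (u ++ w ++ v) ∈ M₁.pathVals k M₂ (((M₁.T u).trans g).trans (N₂.T v))
        (u.length + L + v.length) := by
    intro w hwd hwl hwn hwT
    refine ⟨u ++ w ++ v, digits_append (digits_append hud hwd) hvd,
      by rw [List.length_append, List.length_append, hwl], ?_, ?_, rfl⟩
    · rw [next_append, next_append, hun, hwn, hvn]
    · rw [T_append, T_append, next_append, hun, hwn, hwT]
  have hval : ∀ w : List ℕ, w.length = L →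
      wordVal k (u ++ w ++ v) = wordVal k u * k ^ (L + v.length) + wordVal k w * k ^ v.length +
        wordVal k v := by
    intro w hwl
    rw [wordVal_append, wordVal_append, hwl, pow_add]
    ring
  have h := Nat.setGcd_dvd_of_mem (s := {z | ∃ x ∈ M₁.pathVals k M₂ (((M₁.T u).trans g).trans (N₂.T v))
      (u.length + L + v.length), ∃ y ∈ M₁.pathVals k M₂ (((M₁.T u).trans g).trans (N₂.T v))
      (u.length + L + v.length), y ≤ x ∧ z = x - y})
    ⟨_, hmem w₁ h₁d h₁l h₁n h₁T, _, hmem w₂ h₂d h₂l h₂n h₂T,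
      by rw [hval w₁ h₁l, hval w₂ h₂l]; nlinarith [Nat.zero_le (k ^ v.length)], rfl⟩
  rw [diffGcd]
  rw [hval w₁ h₁l, hval w₂ h₂l] at h
  have : wordVal k u * k ^ (L + v.length) + wordVal k w₁ * k ^ v.length + wordVal k v -
      (wordVal k u * k ^ (L + v.length) + wordVal k w₂ * k ^ v.length + wordVal k v) =
      k ^ v.length * (wordVal k w₁ - wordVal k w₂) := by
    rw [Nat.mul_sub, mul_comm (k ^ v.length) (wordVal k w₁), mul_comm (k ^ v.length) (wordVal k w₂)]
    omega
  rwa [this] at h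

/-- **`d'(q₁,q₂) ∣ d(q̄₁,q̄₂)`** across arbitrary states and classes (Müllner, proof of Lemma 2.19,
with arbitrary connecting paths in place of identity paths — their outputs only relabel `g`).
[cite: Mullner2017, Lemma 2.19 (proof)] -/
theorem dPrime_dvd_limitDiffGcd (hk : 2 ≤ k) (htriv : ∀ q d, k ≤ d → δ q d = q)
    (M₁ M₂ N₁ N₂ : MinImage δ) (c₁ c₂ : ZMod (transducerPeriod k δ)) :
    M₁.dPrime hk htriv M₂ c₁ ∣ N₁.limitDiffGcd hk htriv N₂ c₂ := by
  have hk0 : 0 < k := by omega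
  haveI : NeZero (transducerPeriod k δ) := ⟨(transducerPeriod_pos hk0 htriv).ne'⟩
  -- stabilisation thresholds
  obtain ⟨m₁, hm₁⟩ := M₁.exists_forall_diffGcd_eq_limitDiffGcd hk htriv M₂ c₁
  obtain ⟨m₂, hm₂⟩ := N₁.exists_forall_diffGcd_eq_limitDiffGcd hk htriv N₂ c₂
  -- a connecting path `v : N₂ → M₂` (any) and `u : M₁ → N₁` in the right class
  obtain ⟨N₀, hN₀⟩ := exists_forall_exists_next_eq hk0 htriv (δ := δ)
  obtain ⟨v, hvd, -, hvn⟩ := hN₀ N₂ M₂ N₀ le_rfl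
  -- the class of `u` must be `c₁ - c₂ - |v|`
  set cu : ZMod (transducerPeriod k δ) := c₁ - c₂ - (v.length : ZMod (transducerPeriod k δ)) with hcu
  obtain ⟨u, hud, hul, hun⟩ := hN₀ M₁ N₁ (N₀ * transducerPeriod k δ + cu.val)
    (by nlinarith [cu.val.zero_le, transducerPeriod_pos hk0 htriv (δ := δ)])
  have hucl : (u.length : ZMod (transducerPeriod k δ)) = cu := by
    rw [hul]; push_cast; rw [ZMod.natCast_self, mul_zero, zero_add, ZMod.natCast_zmod_val]
  -- a long stabilised length `L = c₂.val + K d` for `(N₁, N₂, c₂)` such that `|u| + L + |v|` is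
  -- stabilised for `(M₁, M₂, c₁)`
  set K := m₁ + m₂ + u.length + v.length + 1 with hK
  set L := c₂.val + K * transducerPeriod k δ with hL
  -- total length in the class `c₁`: `|u| + L + |v| = c₁.val + K' d`
  have htot_class : ((u.length + L + v.length : ℕ) : ZMod (transducerPeriod k δ)) = c₁ := by
    push_cast
    rw [hucl, hL, Nat.cast_add, Nat.cast_mul, ZMod.natCast_self, mul_zero, add_zero,
      ZMod.natCast_zmod_val, hcu]
    ring
  obtain ⟨K', hK'⟩ : ∃ K', u.length + L + v.length = c₁.val + K' * transducerPeriod k δ := by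
    have h1 : (u.length + L + v.length) % transducerPeriod k δ = c₁.val := by
      rw [← ZMod.val_natCast, htot_class]
    exact ⟨(u.length + L + v.length) / transducerPeriod k δ, by
      rw [← h1, mul_comm]; exact (Nat.mod_add_div _ _).symm⟩
  have hK'ge : m₁ ≤ K' := by
    -- `K' d ≥ L - c₁.val ≥ K d - d + … `: crude bound `K' * d + c₁.val ≥ L ≥ K * d ≥ K ≥ m₁ + c₁.val…`
    have hd := transducerPeriod_pos hk0 htriv (δ := δ)
    have h1 : c₁.val < transducerPeriod k δ := c₁.val_lt
    have h2 : K * transducerPeriod k δ ≤ c₁.val + K' * transducerPeriod k δ := by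
      rw [← hK', hL]; omega
    by_contra hcon
    have h3 : K' + 1 ≤ m₁ := by omega
    have h4 : (K' + 1) * transducerPeriod k δ ≤ m₁ * transducerPeriod k δ :=
      Nat.mul_le_mul_right _ h3
    have h5 : m₁ * transducerPeriod k δ < K * transducerPeriod k δ :=
      Nat.mul_lt_mul_of_pos_right (by omega) hd
    nlinarith
  -- pick any `g ∈ G_{N₁N₂}(c₂)`; the transported output
  obtain ⟨g, hg⟩ := pathOutputs_nonempty hk0 htriv N₁ N₂ c₂
  set g' := ((M₁.T u).trans g).trans (N₂.T v) with hg'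
  have hg'mem : g' ∈ M₁.pathOutputs k M₂ c₁ := by
    have hu' : M₁.T u ∈ M₁.pathOutputs k N₁ cu := by
      rw [← hucl, ← hun]; exact M₁.T_mem_pathOutputs hud
    have hv' : N₂.T v ∈ N₂.pathOutputs k M₂ (v.length : ZMod (transducerPeriod k δ)) := by
      rw [← hvn]; exact N₂.T_mem_pathOutputs hvd
    have := trans_mem_pathOutputs (trans_mem_pathOutputs hu' hg) hv'
    rwa [hcu, show c₁ - c₂ - (v.length : ZMod (transducerPeriod k δ)) + c₂ +
      (v.length : ZMod (transducerPeriod k δ)) = c₁ by ring] at this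
  -- `d_{g', total} = d(M₁,M₂,c₁)` and `d_{g, L} = d(N₁,N₂,c₂)`
  have hstab₁ : M₁.diffGcd k M₂ g' (u.length + L + v.length) = M₁.limitDiffGcd hk htriv M₂ c₁ := by
    rw [hK']; exact hm₁ g' hg'mem K' hK'ge
  have hstab₂ : N₁.diffGcd k N₂ g L = N₁.limitDiffGcd hk htriv N₂ c₂ := hm₂ g hg K (by omega)
  -- `d'(M₁,M₂,c₁) ∣ k^{|v|} z` for every difference `z` of `(N₁,N₂,g,L)`, and is prime to `k^{|v|}`
  rw [← hstab₂, diffGcd, Nat.dvd_setGcd_iff]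
  rintro z ⟨x, hx, y, hy, hyx, rfl⟩
  have h := diffGcd_dvd_mul_of_transport hud hun hvd hvn hx hy hyx
  rw [← hg', hstab₁] at h
  exact (coprime_pow_dPrime hk htriv M₁ M₂ c₁ v.length).symm.dvd_of_dvd_mul_left
    ((dPrime_dvd_limitDiffGcd_self hk htriv M₁ M₂ c₁).trans h)

/-- **Müllner 2017, Lemma 2.19: `d'(A)` is an invariant** — `d'(q,q̄)` (here on any class) does not
depend on the states or the class. [cite: Mullner2017, Lemma 2.19] -/
theorem dPrime_eq (hk : 2 ≤ k) (htriv : ∀ q d, k ≤ d → δ q d = q) (M₁ M₂ N₁ N₂ : MinImage δ)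
    (c₁ c₂ : ZMod (transducerPeriod k δ)) :
    M₁.dPrime hk htriv M₂ c₁ = N₁.dPrime hk htriv N₂ c₂ := by
  apply Nat.dvd_antisymm
  · exact Nat.dvd_gcd (dPrime_dvd_limitDiffGcd hk htriv M₁ M₂ N₁ N₂ c₁ c₂)
      (dPrime_dvd_pow_sub_one hk htriv M₁ M₂ c₁)
  · exact Nat.dvd_gcd (dPrime_dvd_limitDiffGcd hk htriv N₁ N₂ M₁ M₂ c₂ c₁)
      (dPrime_dvd_pow_sub_one hk htriv N₁ N₂ c₂)

end MinImage

section DPrime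

variable {σ : Type*} [Fintype σ] [DecidableEq σ]

/-- `d'(A)`: the invariant of Lemma 2.19 (at the base point, class `0`). [cite: Mullner2017, Lemma 2.19] -/
def transducerDPrime {k : ℕ} (hk : 2 ≤ k) (δ : σ → ℕ → σ) (htriv : ∀ q d, k ≤ d → δ q d = q) : ℕ :=
  (transducerBase δ).dPrime hk htriv (transducerBase δ) 0

/-- Every `d'(q, q̄)` equals `d'(A)`. [cite: Mullner2017, Lemma 2.19] -/
theorem MinImage.dPrime_eq_transducerDPrime {k : ℕ} (hk : 2 ≤ k) {δ : σ → ℕ → σ}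
    (htriv : ∀ q d, k ≤ d → δ q d = q) (M M' : MinImage δ) (c : ZMod (transducerPeriod k δ)) :
    M.dPrime hk htriv M' c = transducerDPrime hk δ htriv :=
  MinImage.dPrime_eq hk htriv M M' _ _ c 0

/-- `d'(A) ∣ k^d − 1`, in particular `d'(A)` is prime to `k`. [cite: Mullner2017, Thm. 2.16] -/
theorem transducerDPrime_dvd {k : ℕ} (hk : 2 ≤ k) (δ : σ → ℕ → σ) (htriv : ∀ q d, k ≤ d → δ q d = q) :
    transducerDPrime hk δ htriv ∣ k ^ transducerPeriod k δ - 1 :=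
  MinImage.dPrime_dvd_pow_sub_one hk htriv _ _ 0

end DPrime

end Literature.NumberTheory.LFunctions
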